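/-
Copyright: b2b-lace packet (LEAN typing seat 1, gen 33).  REGION-SPLIT: the region `{‖x‖₁ ≥ m₀}` of `ℤ^d` splits,
modulo the hyperoctahedral group `W_d`, into the AXIS FAMILY `{a e₁ : a ≥ m₀}` and the sorted MULTI-SUPPORT cone;
sup lemmas that take the axis-family bound as an EXTERNAL hypothesis.  d-generic; no numeral table; no `sorry`.
-/
import Literature.Probability.FitznerVanDerHofstad2017.SrwIntegralSortedMonotone
import HarnessLib

/-!
# REGION-SPLIT: `{‖x‖₁ ≥ m₀}` = axis family `{± a e_ι : a ≥ m₀}` ∪ multi-support cone, and the sup lemmas with an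
  external axis-family bound

CITATION HEADER (PLACEMENT v2). This module is part of a certified REPRODUCTION of:
R. Fitzner, R. van der Hofstad, *Mean-field behavior for nearest-neighbor percolation in d > 10*,
Electron. J. Probab. 22 (2017), no. 43 [FvdH17], and *Generalized approach to the non-backtracking lace
expansion*, Probab. Theory Related Fields 169 (2017) 1041–1119 [NoBLE17-I] (arXiv:1506.07977, 1506.07969).
Reproduces: the LOCATION OF SUPREMA over `x` of the SRW inputs `K_{n,l}(x)`, `U_{n,l}(x)`, `T_{n,l}(x)` ((5.15),
(5.9)/(5.12), (5.11) p. 1091–1092) on the regions `{Σ_μ |x_μ| ≥ m₀}` read by the bootstrap functions — [NoBLE17-I]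
§5.1 p. 1093 ("by Lemma 5.1 it suffices to consider the minimal elements … `3e₁, 2e₁+e₂, e₁+e₂+e₃`") and
[HS92b] T. Hara, G. Slade, Rev. Math. Phys. 4 (1992), App. B, Lemma B.4 (sorted monotonicity).  Origin: build `lace`,
node KU-CF (carver-g42, `HOME/carver/g42/kuja/KU-CF-SPEC.md` §4 "REGION-SPLIT"), leaf REGION-SPLIT, typing seat 1
(lean1-g33); companion of `SrwIntegralSortedMonotone` (the node families) and of the `d = 10` sup-literal modules
`SrwKSupTableD10` / `SrwTUSupTableD10` (which bound the axis family by the single node `m₀ e₁` through Cauchy–Schwarz).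

## What is here (all `d`-generic)

The landed sup lemmas (`srwK_le_of_nodeSplits_two/three`, `TUSupD10.srwU_le_of_nodeRules_two/three`, …) sort `|x|`
by a signed permutation and split on the number of non-zero coordinates `suppCount`; on the ONE-coordinate branch (the
axis family `a e₁`, `a ≥ m₀`) they use the sorted antitonicity of `W_{n,j}` / `L_n` to move to the node `m₀ e₁` and
then Cauchy–Schwarz.  The characteristic-function route KU-CF (carver-g42) evaluates `K`/`U` ON THE AXIS FAMILY
directly and m-uniformly, so the consumer wants the same split with the axis branch left OPEN as a hypothesis:

* `vecOfParts_single_eq_single` — the sorted axis representative is `vecOfParts d [a] = a e₀` (`Pi.single 0 a`);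
* `le_of_axis_or_multi` — THE SPLIT: for a `W_d`-invariant `F` (`SpInvariant F`) and `m₀ ≥ 1`, if
  `F (a e₀) ≤ B` for all `a ≥ m₀` and `F y ≤ B` for every sorted `y ≥ 0` with `suppCount y ≥ 2` and `Σ y ≥ m₀`,
  then `F x ≤ B` whenever `Σ_μ |x_μ| ≥ m₀`.  (For `m₀ = 3` the multi-support cone is `{sorted |x| ≥ (2,1,0,…)} ∪
  {sorted |x| ≥ (1,1,1,0,…)}`, for `m₀ = 2` it is `{sorted |x| ≥ (1,1,0,…)}` — the tree expresses these through
  `suppCount` and the node lemmas below.)  `max` form: `le_max_of_axis_or_multi`.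
* `le_of_multiNodeBounds_two`, `le_of_multiNodeBounds_three` — the multi-support cone for a SORTED-ANTITONE `G`
  (`W_{n,j}`, `L_n`: `sortedAntitone_srwW`, `sortedAntitone_srwL`): nodes `1^r` (`2 ≤ r ≤ d`), resp. the pair
  `2e₁+e₂`, `2e₁+2e₂` and `1^r` (`3 ≤ r ≤ d`) — `le_classVec_suppCount_of_antitone` / `le_pair_nodes_of_suppCount_eq_two`
  restricted to the multi-support branch, so that a consumer of `le_of_axis_or_multi` discharges the cone by the
  LANDED node literals unchanged.
* `srwK_le_of_axisBound_nodeSplits_two`, `srwK_le_of_axisBound_nodeSplits_three` — the `K`-specialisation: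
  `srwK_le_of_nodeSplits_two/three` of `SrwKSupTableD10` §1 with the axis-node split at `2e₁` / `3e₁` REPLACED by the
  external axis-family hypothesis `∀ a ≥ m₀, K_{n,l}(a e₀) ≤ A`, the cone splits (per-node Cauchy–Schwarz with the
  sorted-antitone `W`) unchanged; conclusion `K_{n,l}(x) ≤ max A C`.

## What is NOT here
No dimension, no table, no value of any `K`/`U`/`T`; in particular NO axis-family bound is proved here (that is the
certification leaf KU-CF-ENCL / BESSEL-QUAD of node KU-CF) — this module only fixes the shape of the slot it fills.
Nothing of record (CERT REV 14, `d = 11`) and no `d = 10` module is touched; no `…Of`/`…At` instance.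
-/

namespace Literature.Probability.FitznerVanDerHofstad2017

open _root_.MeasureTheory Finset
open scoped BigOperators

variable {d : ℕ}

/-! ### §1. The axis representative and the split -/

/-- The sorted axis representative `vecOfParts d [a]` is `a e₀` (the node `m e₁` of [NoBLE17-I] §5.1).
[cite: FitznerVanDerHofstad2016NoBLE, §5.1 p. 1093] -/
theorem vecOfParts_single_eq_single (hd : 1 ≤ d) (a : ℕ) :
    vecOfParts d [a] = Pi.single (⟨0, hd⟩ : Fin d) (a : ℤ) := by
  funext μ
  rw [vecOfParts_single_apply]
  by_cases h : (μ : ℕ) = 0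
  · have hμ : μ = ⟨0, hd⟩ := Fin.ext h
    subst hμ
    simp
  · have hμ : μ ≠ ⟨0, hd⟩ := fun h' => h (by rw [h'])
    rw [if_neg h, Pi.single_eq_of_ne hμ]

/-- **REGION-SPLIT.**  For a `W_d`-invariant `F` and `m₀ ≥ 1`: an axis-family bound (`F (a e₀) ≤ B`, `a ≥ m₀`) and a
multi-support bound (`F y ≤ B` for sorted `y ≥ 0` with at least two non-zero coordinates and `Σ y ≥ m₀`) give
`F x ≤ B` on the whole region `Σ_μ |x_μ| ≥ m₀`.
[cite: FitznerVanDerHofstad2016NoBLE, §5.1 p. 1093; HaraSlade1992b, App. B, Lemma B.4] -/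
theorem le_of_axis_or_multi (F : (Fin d → ℤ) → ℝ) (hI : SpInvariant F) (B : ℝ) {m₀ : ℕ} (hm₀ : 1 ≤ m₀)
    (hax : ∀ a : ℕ, m₀ ≤ a → F (vecOfParts d [a]) ≤ B)
    (hmulti : ∀ y : Fin d → ℤ, Antitone y → (∀ i, 0 ≤ y i) → 2 ≤ suppCount y → (m₀ : ℤ) ≤ ∑ j, y j → F y ≤ B)
    (x : Fin d → ℤ) (hx : (m₀ : ℤ) ≤ ∑ j, |x j|) : F x ≤ B := by
  obtain ⟨τ, hanti, hnn, hsum, -⟩ := exists_spAct_sorted x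
  rw [← hI τ x]
  rw [← hsum] at hx
  set y := spAct τ x with hydef
  have hy : y ≠ 0 := by
    intro h
    rw [h] at hx
    simp only [Pi.zero_apply, sum_const_zero] at hx
    have : (1 : ℤ) ≤ m₀ := by exact_mod_cast hm₀
    omega
  have hr1 := one_le_suppCount y hy
  rcases Nat.lt_or_ge 1 (suppCount y) with hr2 | hr1'
  · exact hmulti y hanti hnn hr2 hx
  · have h1 : suppCount y = 1 := le_antisymm hr1' hr1
    obtain ⟨a, -, hsa, hya⟩ := eq_vecOfParts_single_of_suppCount_eq_one y hanti hnn h1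
    rw [hsa] at hx
    rw [hya]
    exact hax a (by exact_mod_cast hx)

/-- `max` form of the split: axis family `≤ A`, multi-support cone `≤ C` ⇒ region `≤ max A C`.
[cite: FitznerVanDerHofstad2016NoBLE, §5.1 p. 1093] -/
theorem le_max_of_axis_or_multi (F : (Fin d → ℤ) → ℝ) (hI : SpInvariant F) (A C : ℝ) {m₀ : ℕ} (hm₀ : 1 ≤ m₀)
    (hax : ∀ a : ℕ, m₀ ≤ a → F (vecOfParts d [a]) ≤ A)
    (hmulti : ∀ y : Fin d → ℤ, Antitone y → (∀ i, 0 ≤ y i) → 2 ≤ suppCount y → (m₀ : ℤ) ≤ ∑ j, y j → F y ≤ C)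
    (x : Fin d → ℤ) (hx : (m₀ : ℤ) ≤ ∑ j, |x j|) : F x ≤ max A C :=
  le_of_axis_or_multi F hI (max A C) hm₀ (fun a ha => (hax a ha).trans (le_max_left _ _))
    (fun y hy hy0 h2 hs => (hmulti y hy hy0 h2 hs).trans (le_max_right _ _)) x hx

/-! ### §2. The multi-support cone for a sorted-antitone `G` -/

/-- Multi-support cone, region `‖·‖₁ ≥ 2`: a sorted-antitone `G` is bounded on every sorted `y ≥ 0` with
`suppCount y ≥ 2` by its values at the nodes `1^r`, `2 ≤ r ≤ d`. [cite: HaraSlade1992b, App. B, Lemma B.4] -/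
theorem le_of_multiNodeBounds_two (G : (Fin d → ℤ) → ℝ) (hG : SortedAntitone G) (B : ℝ)
    (hB : ∀ r : ℕ, 2 ≤ r → r ≤ d → G (classVec d r 0) ≤ B)
    (y : Fin d → ℤ) (hy : Antitone y) (hy0 : ∀ i, 0 ≤ y i) (h2 : 2 ≤ suppCount y) : G y ≤ B :=
  (le_classVec_suppCount_of_antitone G hG y hy hy0).trans (hB _ h2 (suppCount_le _))

/-- Multi-support cone, region `‖·‖₁ ≥ 3`: a sorted-antitone `G` is bounded on every sorted `y ≥ 0` with
`suppCount y ≥ 2` and `Σ y ≥ 3` by its values at the pair `2e₁+e₂`, `2e₁+2e₂` and at `1^r`, `3 ≤ r ≤ d`.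
[cite: FitznerVanDerHofstad2016NoBLE, §5.1 p. 1093; HaraSlade1992b, App. B, Lemma B.4] -/
theorem le_of_multiNodeBounds_three (G : (Fin d → ℤ) → ℝ) (hG : SortedAntitone G) (B : ℝ)
    (h21 : G (vecOfParts d [2, 1]) ≤ B) (h22 : G (vecOfParts d [2, 2]) ≤ B)
    (hB : ∀ r : ℕ, 3 ≤ r → r ≤ d → G (classVec d r 0) ≤ B)
    (y : Fin d → ℤ) (hy : Antitone y) (hy0 : ∀ i, 0 ≤ y i) (h2 : 2 ≤ suppCount y) (h3 : 3 ≤ ∑ j, y j) :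
    G y ≤ B := by
  rcases Nat.lt_or_ge 2 (suppCount y) with hr3 | hr2
  · exact (le_classVec_suppCount_of_antitone G hG y hy hy0).trans (hB _ hr3 (suppCount_le _))
  · have h2' : suppCount y = 2 := le_antisymm hr2 h2
    exact (le_pair_nodes_of_suppCount_eq_two G hG y hy hy0 h2' h3).trans (max_le h21 h22)

/-! ### §3. The `K`-specialisation: external axis-family bound + per-node Cauchy–Schwarz on the cone -/

/-- `√I · √(max W₁ W₂) ≤ B` from the two splits. [folklore] -/
private theorem sqrt_mul_sqrt_max_le' {I W₁ W₂ B : ℝ} (h₁ : Real.sqrt I * Real.sqrt W₁ ≤ B)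
    (h₂ : Real.sqrt I * Real.sqrt W₂ ≤ B) : Real.sqrt I * Real.sqrt (max W₁ W₂) ≤ B := by
  rcases le_total W₁ W₂ with h | h
  · rwa [max_eq_right h]
  · rwa [max_eq_left h]

/-- **`sup_{‖x‖₁ ≥ 2} K_{n,l}` with an external axis-family bound** (`n ≥ 1`, `d ≥ 2n+1`): if `K_{n,l}(a e₀) ≤ A` for
every `a ≥ 2` and the nodes `1^r` (`2 ≤ r ≤ d`) carry Cauchy–Schwarz splits `√I_{n,2m}(0) √W_{n,j}(1^r) ≤ C`
(`m + j = l`), then `K_{n,l}(x) ≤ max A C` whenever `Σ_μ |x_μ| ≥ 2`.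
[cite: FitznerVanDerHofstad2016NoBLE, (5.15)–(5.16) p. 1092 and §5.1 p. 1093] -/
theorem srwK_le_of_axisBound_nodeSplits_two {n : ℕ} (hn : 1 ≤ n) (hd : 2 * n + 1 ≤ d) (l : ℕ) (A C : ℝ)
    (hax : ∀ a : ℕ, 2 ≤ a → srwK d n l (vecOfParts d [a]) ≤ A)
    (hC : ∀ r : ℕ, 2 ≤ r → r ≤ d → ∃ m j, m + j = l ∧
      Real.sqrt (srwI d n (2 * m) 0) * Real.sqrt (srwW d n j (classVec d r 0)) ≤ C)
    (x : Fin d → ℤ) (hx : 2 ≤ ∑ j, |x j|) : srwK d n l x ≤ max A C := by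
  refine le_max_of_axis_or_multi (srwK d n l) (fun τ x => srwK_spAct n l τ x) A C (m₀ := 2) (by norm_num)
    hax (fun y hy hy0 h2 _ => ?_) x (by exact_mod_cast hx)
  obtain ⟨m, j, rfl, hle⟩ := hC _ h2 (suppCount_le _)
  exact (srwK_le_sqrt_of_srwW_le hd m j y
    (le_classVec_suppCount_of_antitone _ (sortedAntitone_srwW hn hd j) y hy hy0)).trans hle

/-- **`sup_{‖x‖₁ ≥ 3} K_{n,l}` with an external axis-family bound** (`n ≥ 1`, `d ≥ 2n+1`): if `K_{n,l}(a e₀) ≤ A`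
for every `a ≥ 3`, the pair `{2e₁+e₂, 2e₁+2e₂}` carries one common split `≤ C` and the nodes `1^r` (`3 ≤ r ≤ d`)
carry splits `≤ C`, then `K_{n,l}(x) ≤ max A C` whenever `Σ_μ |x_μ| ≥ 3`.
[cite: FitznerVanDerHofstad2016NoBLE, (5.15)–(5.16) p. 1092 and §5.1 p. 1093] -/
theorem srwK_le_of_axisBound_nodeSplits_three {n : ℕ} (hn : 1 ≤ n) (hd : 2 * n + 1 ≤ d) (l : ℕ) (A C : ℝ)
    (hax : ∀ a : ℕ, 3 ≤ a → srwK d n l (vecOfParts d [a]) ≤ A)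
    (h2x : ∃ m j, m + j = l ∧
      Real.sqrt (srwI d n (2 * m) 0) * Real.sqrt (srwW d n j (vecOfParts d [2, 1])) ≤ C ∧
      Real.sqrt (srwI d n (2 * m) 0) * Real.sqrt (srwW d n j (vecOfParts d [2, 2])) ≤ C)
    (hC : ∀ r : ℕ, 3 ≤ r → r ≤ d → ∃ m j, m + j = l ∧
      Real.sqrt (srwI d n (2 * m) 0) * Real.sqrt (srwW d n j (classVec d r 0)) ≤ C)
    (x : Fin d → ℤ) (hx : 3 ≤ ∑ j, |x j|) : srwK d n l x ≤ max A C := by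
  refine le_max_of_axis_or_multi (srwK d n l) (fun τ x => srwK_spAct n l τ x) A C (m₀ := 3) (by norm_num)
    hax (fun y hy hy0 h2 h3 => ?_) x (by exact_mod_cast hx)
  rcases Nat.lt_or_ge 2 (suppCount y) with hr3 | hr2
  · obtain ⟨m, j, rfl, hle⟩ := hC _ hr3 (suppCount_le _)
    exact (srwK_le_sqrt_of_srwW_le hd m j y
      (le_classVec_suppCount_of_antitone _ (sortedAntitone_srwW hn hd j) y hy hy0)).trans hle
  · have h2' : suppCount y = 2 := le_antisymm hr2 h2
    obtain ⟨m, j, rfl, hle1, hle2⟩ := h2x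
    exact (srwK_le_sqrt_of_srwW_le hd m j y
      (le_pair_nodes_of_suppCount_eq_two _ (sortedAntitone_srwW hn hd j) y hy hy0 h2'
        (by exact_mod_cast h3))).trans (sqrt_mul_sqrt_max_le' hle1 hle2)

/-- The axis family is a `W_d`-orbit family: for a `W_d`-invariant `F`, a bound at the sorted representatives
`a e₀` is a bound at every `± a e_ι` (the symmetry reduction of [NoBLE17-I] §5.1 / [HS92b] Lemma B.4).
[cite: FitznerVanDerHofstad2016NoBLE, §5.1 p. 1093; HaraSlade1992b, App. B, Lemma B.4] -/
theorem le_of_axisBound_single (F : (Fin d → ℤ) → ℝ) (hI : SpInvariant F) (B : ℝ) {m₀ : ℕ} (hm₀ : 1 ≤ m₀)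
    (hax : ∀ a : ℕ, m₀ ≤ a → F (vecOfParts d [a]) ≤ B) (ι : Fin d) (c : ℤ) (hc : (m₀ : ℤ) ≤ |c|) :
    F (Pi.single ι c) ≤ B := by
  classical
  have hc0 : c ≠ 0 := by
    rintro rfl
    simp only [abs_zero] at hc
    have : (1 : ℤ) ≤ m₀ := by exact_mod_cast hm₀
    omega
  obtain ⟨τ, hanti, hnn, hsum, habs⟩ := exists_spAct_sorted (Pi.single ι c : Fin d → ℤ)
  rw [← hI τ]
  set y := spAct τ (Pi.single ι c) with hydef
  -- `y` is sorted with the single non-zero entry `|c|`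
  have hsum' : ∑ j, y j = |c| := by
    rw [hsum, ← Finset.sum_erase_add _ _ (mem_univ ι), Pi.single_eq_same,
      Finset.sum_eq_zero (fun j hj => by rw [Pi.single_eq_of_ne (Finset.ne_of_mem_erase hj), abs_zero]), zero_add]
  have hcnt : suppCount y = 1 := by
    unfold suppCount
    rw [Finset.card_eq_one]
    refine ⟨τ.1.symm ι, ?_⟩
    ext j
    simp only [Finset.mem_filter, Finset.mem_univ, true_and, Finset.mem_singleton]
    rw [show y j = |(Pi.single ι c : Fin d → ℤ) (τ.1 j)| from habs j]
    constructor
    · intro h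
      by_contra hne
      apply h
      rw [Pi.single_eq_of_ne (fun h' => hne (by rw [← h', Equiv.symm_apply_apply])), abs_zero]
    · intro h
      rw [h, Equiv.apply_symm_apply, Pi.single_eq_same]
      exact abs_ne_zero.mpr hc0
  obtain ⟨a, -, hsa, hya⟩ := eq_vecOfParts_single_of_suppCount_eq_one y hanti hnn hcnt
  rw [hya]
  refine hax a ?_
  have : (m₀ : ℤ) ≤ (a : ℤ) := by rw [← hsa, hsum']; exact hc
  exact_mod_cast this

end Literature.Probability.FitznerVanDerHofstad2017
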